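import Summits.QuantumFields.BalabanUV.Beta.D1BFx.NeedleProjLetters
import Summits.QuantumFields.BalabanUV.Beta.D1BFx.RankOneBubbleJets
import Summits.QuantumFields.BalabanUV.Beta.D1BFx.NeedleGhostBubble2Row

/-!
# `BalabanUV.Beta.D1BFx.NeedleColumnLetters` — road «BF-x» for binder row D1, slot (K), END row `hGrp gN`, «GN-N LETTERS (column side)»: THE SCALAR LETTERS OF THE
# COMBINED COLUMN `C_u(q) = cQ·Σ_{z∈B(blk u)} Pgt z q − kerP q (blk u)` OF THE NEEDLE ⊗ COLUMN PIECE AGAINST THE GLUON LEG — the point value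
# `|(Ga ∇C_u)(x,α)| ≤ kN·(|cQ|·cPPs + cPs)·n·e^{−δ₂·dist(blk x, blk u)}` (block mass `C·n²` × `|∇C_u| ≤ C₀∕n` = `n¹`, an3-g57 §3′ (4): «`(Ga∇C)(u′,μ) ≤ S′_C·kn² = k·n`»),
# and the two decaying pairings `|⟨Ga ∇C_u, ∇_row P(p,·)⟩| ≤ kNP·(…)·e^{−δ₃·dist(blk u, blk p)}`, `|⟨∇C_u, Ga ∇_col P(·,q)⟩| ≤ kCP·(…)·e^{−δ₃·dist(blk u, blk q)}` (both n⁰),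
# modulo [B5, Prop. 1.2] ∧ [B5, (1.126)–(1.127)] BY NAME

HONEST DEPENDENCY (cell records, verbatim): «continuum YM on T⁴ ⇐ BetaPertH ∧ nine spine estimates (0/9 proved); BetaPertH ⇐ (D1) ∧ (D4) ∧
CAP+tail; G-an2-4 gates asym, D1 and NE2/3/4.»  HONEST FRAMING (cell contract, verbatim): «discharging `BetaPertH` makes Bałaban's UV stability
UNCONDITIONAL — a real constructive-QFT result; it is NOT the continuum limit and NOT the Clay problem.»  THIS MODULE DISCHARGES NOTHING of the
wall: [folklore] lattice bookkeeping BY NAME over the owner's (L1)-MASS `GluonLegBlockMass.exists_sum_B_sum_abs_Ga_le`, kC `NeedleProjLetters.exists_applyK_colGrad_le`,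
gan24-leaf-05's `ProjectorColumnSharp.abs_combinedColumn_diff_le_sup` and `ProjectorSupNorm.abs_Pgt_diff_le_sup`, the block tools `NeedleRowLetters.tsum_eq_tsum_blocks`,
`RProjector.abs_tsum_le_latticeConst`, `B6QGQDecay237.card_B`.  No `def`, no `def … : Prop`, nothing cited, 0 sorry; printed statements are HYPOTHESES by name.
Root-level binders hW ∕ hR-sockets ∕ hSX-socket ∕ D1Tel ∕ D1Rep — 0 discharged; (K) NOT closed; NOT D1, NOT `BetaPertH`, NOT continuum, NOT Clay.

ABSOLUTE RULE (cell charter, verbatim): «No internally-minted statement may enter as a cited fact. Every hypothesis is either kernel-proved in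
this package or a verbatim quotation of a PUBLISHED theorem with page reference. The manuscript(s) under audit are NOT citable for their own
disputed steps — they are the thing under adjudication; programme-internal (2001/route/tribunal) claims are never citable.»

WHY (owner claim table «GN-CELLS» v0.2 + «GN-NDL-SHAPE» `NeedleNdlShape.bubble_ndl_dJetSw` (p263835): the `ndl ⊗ proj` word is
`[⟨∇ρ, Ga c′⟩·(Ga∇C)(u′,κ′) − (∇ρ Ga)(u′,κ′)·⟨Ga∇C, r′⟩] − [⟨∇C, Ga c′⟩·(Ga∇ρ)(u′,κ′) − (∇C Ga)(u′,κ′)·⟨Ga∇ρ, r′⟩]`; this file bounds the three shapes in which the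
COLUMN factor `C_u` meets the leg, each with its block decay from the needle's block `blk u` — the decay the (1.22) sum of the cell consumes).  `C_u` is written INLINE.

CONTENT (`a > 0`, `n ≥ 1`).
* §1 [folklore] `applyKT_eq_applyK_of_symm` (for the symmetric leg: `applyKT ψ (Ga n a) = applyK (Ga n a) ψ`), `abs_gradC_le` (the `∇C_u` letter at the common rate `δ_C := min δ_PP δ_P`).
* §2 [folklore] **`exists_applyK_gradC_le`** (kN: `≤ kN·(|cQ|·cPPs 4 a + cPs 4 a)·n·e^{−δ₂·dist(blk x, blk u)}`).
* §3 [folklore] **`exists_pairing_applyK_gradC_rowGrad_le`** (kNP: n⁰ with decay `dist(blk u, blk p)`), **`exists_pairing_gradC_applyK_colGrad_le`** (kCP: n⁰ with decay `dist(blk u, blk q)`).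
NOT HERE (honest): the needle-potential side (ρ_u = `ndlRow`) — next file; any cell.
Unit `b2b-balaban-beta-d1-p2` (gen 10), road «BF-x» OWNER; `LEAVES-BFx.md` row (N) «GN-N LETTERS».
-/

namespace Summit.QuantumFields.BalabanUV.Beta.D1BFx.NeedleColumnLetters

open Finset Real
open scoped BigOperators
open Literature.MathematicalPhysics.QuantumFieldTheory.Balaban1983to89
open Literature.MathematicalPhysics.QuantumFieldTheory.Balaban1983to89.Beta
open B12Sec2to5 (l1 l1_nonneg)
open B4Sect5Proof (latticeConst latticeConst_nonneg)
open B6QGQLower276 (X e blk B mem_B)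
open B6QGQDecay237 (card_B)
open ExpKernelCalculus (Site MKer Decays summable_exp_shift)
open DyadicShell (Pt supNorm)
open AffineAveraging (unitVec)
open VectorTailsLoc (fam kfam)
open Summit.QuantumFields.BalabanUV.Beta.TameKernelCalculus (Spr)
open Summit.QuantumFields.BalabanUV.Beta.D1BFx.RProjector (Pgt kerP Pgt_symm abs_tsum_le_latticeConst deltaPP deltaP deltaPP_pos deltaP_pos)
open Summit.QuantumFields.BalabanUV.Beta.D1BFx.ProjectorSupNorm (cPPs cPs cPPs_nonneg cPs_nonneg abs_Pgt_diff_le_sup)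
open Summit.QuantumFields.BalabanUV.Beta.D1BFx.ProjectorColumnSharp (abs_combinedColumn_diff_le_sup)
open Summit.QuantumFields.BalabanUV.Beta.D1BFx.NeedleRowLetters (tsum_eq_tsum_blocks)
open Summit.QuantumFields.BalabanUV.Beta.D1BFx.GluonLeg (Ga Ga_apply Ga_symm)
open Summit.QuantumFields.BalabanUV.Beta.D1BFx.GluonLegTails (spr_Ga_of_prop12)
open Summit.QuantumFields.BalabanUV.Beta.D1BFx.GhostLeg (cast_pred_add_one)
open Summit.QuantumFields.BalabanUV.Beta.D1BFx.FrozenLegTails (nOf MOf hn1)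
open Summit.QuantumFields.BalabanUV.Beta.D1BFx.GluonLegBlockMass (exists_sum_B_sum_abs_Ga_le)
open Summit.QuantumFields.BalabanUV.Beta.D1BFx.RankOneBubble (applyK applyKT pairing applyK_apply applyKT_apply pairing_def pairing_comm)
open Summit.QuantumFields.BalabanUV.Beta.D1BFx.RankOneBubbleJets (grad grad_apply colGrad rowGrad)
open Summit.QuantumFields.BalabanUV.Beta.D1BFx.NeedleProjLetters (exists_applyK_colGrad_le exp_blocks_le unitVec_eq_e')

noncomputable section

variable (a : ℝ) (ha : 0 < a)

/-! ## §1 Symmetry of the leg action; the `∇C_u` letter at one rate -/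

/-- [folklore] **FOR THE SYMMETRIC LEG THE RIGHT ACTION IS THE LEFT ACTION**: `applyKT ψ (Ga n a) = applyK (Ga n a) ψ` (`Ga_symm`). -/
theorem applyKT_eq_applyK_of_symm (ha : 0 < a) (n : ℕ) [NeZero n] (ψ : Site 4 → Fin 4 → ℝ) : applyKT ψ (Ga n a) = applyK (Ga n a) ψ := by
  funext z β
  rw [applyKT_apply, applyK_apply]
  refine tsum_congr fun y => Finset.sum_congr rfl fun α _ => ?_
  rw [Ga_symm n a NeZero.one_le ha y z α β]; ring

/-- [folklore] **THE `∇C_u` LETTER AT THE COMMON RATE** `δ_C := min δ_PP δ_P`: `|C_u(q + e_μ) − C_u(q)| ≤ (|cQ|·cPPs + cPs)∕n · e^{−δ_C·dist(blk u, blk q)}`. -/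
theorem abs_gradC_le (ha : 0 < a) (n : ℕ) [NeZero n] (cQ : ℝ) (u q : Pt) (μ : Fin 4) :
    |grad (fun q => cQ * (∑ z ∈ B (n - 1) (blk (n - 1) u), Pgt n a z q () ()) - kerP (d := 4) (n - 1) a q (blk (n - 1) u)) q μ|
      ≤ (|cQ| * cPPs 4 a + cPs 4 a) / (n : ℝ) * Real.exp (-(min (deltaPP 4 a) (deltaP 4 a) * dist (blk (n - 1) u) (blk (n - 1) q))) := by
  have hn : (0 : ℝ) < n := by exact_mod_cast Nat.pos_of_ne_zero (NeZero.ne n)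
  have h := abs_combinedColumn_diff_le_sup n ha cQ q (blk (n - 1) u) μ () ()
  rw [grad_apply, unitVec_eq_e']
  refine h.trans ?_
  have hd : 0 ≤ dist (blk (n - 1) u) (blk (n - 1) q) := dist_nonneg
  have e1 : Real.exp (-(deltaPP 4 a * dist (blk (n - 1) u) (blk (n - 1) q))) ≤ Real.exp (-(min (deltaPP 4 a) (deltaP 4 a) * dist (blk (n - 1) u) (blk (n - 1) q))) :=
    Real.exp_le_exp.2 (by nlinarith [min_le_left (deltaPP 4 a) (deltaP 4 a)])
  have e2 : Real.exp (-(deltaP 4 a * dist (blk (n - 1) q) (blk (n - 1) u))) ≤ Real.exp (-(min (deltaPP 4 a) (deltaP 4 a) * dist (blk (n - 1) u) (blk (n - 1) q))) := by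
    rw [dist_comm]; exact Real.exp_le_exp.2 (by nlinarith [min_le_right (deltaPP 4 a) (deltaP 4 a)])
  have hc1 : 0 ≤ |cQ| * (cPPs 4 a / (n : ℝ)) := by have := cPPs_nonneg 4 ha; positivity
  have hc2 : 0 ≤ cPs 4 a / (n : ℝ) := by have := cPs_nonneg 4 ha; positivity
  calc |cQ| * (cPPs 4 a / (n : ℝ) * Real.exp (-(deltaPP 4 a * dist (blk (n - 1) u) (blk (n - 1) q))))
        + cPs 4 a / (n : ℝ) * Real.exp (-(deltaP 4 a * dist (blk (n - 1) q) (blk (n - 1) u)))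
      ≤ |cQ| * (cPPs 4 a / (n : ℝ)) * Real.exp (-(min (deltaPP 4 a) (deltaP 4 a) * dist (blk (n - 1) u) (blk (n - 1) q)))
        + cPs 4 a / (n : ℝ) * Real.exp (-(min (deltaPP 4 a) (deltaP 4 a) * dist (blk (n - 1) u) (blk (n - 1) q))) := by
        rw [← mul_assoc]; exact add_le_add (mul_le_mul_of_nonneg_left e1 hc1) (mul_le_mul_of_nonneg_left e2 hc2)
    _ = _ := by field_simp

/-! ## §2 (kN) The point value of `Ga` on the column gradient -/

/-- [folklore] **(kN) `|(Ga ∇C_u)(x,α)| ≤ kN·(|cQ|·cPPs + cPs)·n·e^{−δ₂·dist(blk x, blk u)}`**, modulo [B5, Prop. 1.2] ∧ [B5, (1.126)–(1.127)] BY NAME — one `kN ≥ 0`,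
`δ₂ > 0` for every `n ≥ 1`, `cQ`, `u`, `x`, `α` (block mass `C₁n²e^{−δ₁d}` of the leg × `|∇C_u| ≤ C₀∕n·e^{−δ_C d}` × the coarse triangle; power `n² · n⁻¹ = n`). -/
theorem exists_applyK_gradC_le (h12 : B5.Prop12Printed (fam nOf hn1 MOf a ha)) (h126 : B5.Kernel126_127Printed (kfam nOf MOf)) :
    ∃ kN δ₂ : ℝ, 0 < δ₂ ∧ 0 ≤ kN ∧ ∀ (n : ℕ) [NeZero n] (cQ : ℝ) (u x : Pt) (α : Fin 4),
      |applyK (Ga n a) (grad (fun q => cQ * (∑ z ∈ B (n - 1) (blk (n - 1) u), Pgt n a z q () ()) - kerP (d := 4) (n - 1) a q (blk (n - 1) u))) x α|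
        ≤ kN * (|cQ| * cPPs 4 a + cPs 4 a) * (n : ℝ) * Real.exp (-(δ₂ * dist (blk (n - 1) x) (blk (n - 1) u))) := by
  obtain ⟨C₁, δ₁, hδ₁, hC₁, hmass⟩ := exists_sum_B_sum_abs_Ga_le a ha h12 h126
  have hPP := deltaPP_pos 4 ha; have hP := deltaP_pos 4 ha
  set δC := min (deltaPP 4 a) (deltaP 4 a) with hδC
  have hδC0 : 0 < δC := lt_min hPP hP
  refine ⟨C₁ * latticeConst 4 (δ₁ / 2), min δ₁ δC / 2, half_pos (lt_min hδ₁ hδC0),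
    by have := latticeConst_nonneg 4 (half_pos hδ₁).le; positivity, fun n _ cQ u x α => ?_⟩
  have hn : (0 : ℝ) < n := by exact_mod_cast Nat.pos_of_ne_zero (NeZero.ne n)
  set m : ℕ := n - 1 with hm
  set C₀ : ℝ := |cQ| * cPPs 4 a + cPs 4 a with hC₀
  have hC₀0 : 0 ≤ C₀ := by have := cPPs_nonneg 4 ha; have := cPs_nonneg 4 ha; positivity
  set gC : Site 4 → Fin 4 → ℝ := grad (fun q => cQ * (∑ z ∈ B m (blk m u), Pgt n a z q () ()) - kerP (d := 4) m a q (blk m u)) with hgC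
  set F : Pt → ℝ := fun y => ∑ β : Fin 4, Ga n a x y α β * gC y β with hF
  have happ : applyK (Ga n a) gC x α = ∑' y, F y := rfl
  have hG : ∀ (y : Pt) (β : Fin 4), |gC y β| ≤ C₀ / (n : ℝ) * Real.exp (-(δC * dist (blk m u) (blk m y))) := fun y β => abs_gradC_le a ha n cQ u y β
  have hG' : ∀ (y : Pt) (β : Fin 4), |gC y β| ≤ C₀ / (n : ℝ) := fun y β =>
    (hG y β).trans (mul_le_of_le_one_right (by positivity) (by
      rw [Real.exp_le_one_iff]; have : 0 ≤ δC * dist (blk m u) (blk m y) := by positivity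
      linarith))
  have hFle : ∀ y, |F y| ≤ (∑ β : Fin 4, |Ga n a x y α β|) * (C₀ / (n : ℝ) * Real.exp (-(δC * dist (blk m u) (blk m y)))) := by
    intro y
    calc |F y| ≤ ∑ β : Fin 4, |Ga n a x y α β * gC y β| := Finset.abs_sum_le_sum_abs _ _
      _ ≤ ∑ β : Fin 4, |Ga n a x y α β| * (C₀ / (n : ℝ) * Real.exp (-(δC * dist (blk m u) (blk m y)))) :=
          Finset.sum_le_sum fun β _ => by rw [abs_mul]; exact mul_le_mul_of_nonneg_left (hG y β) (abs_nonneg _)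
      _ = _ := by rw [Finset.sum_mul]
  have hsum : Summable F := by
    obtain ⟨C, δ, hδ, hGa⟩ := spr_Ga_of_prop12 (a := a) (ha := ha) h12 h126 n
    have hC0 : 0 ≤ C := hGa.nonneg α
    refine Summable.of_norm_bounded (g := fun y => ∑ _β : Fin 4, C * Real.exp (-δ * l1 (x - y)) * (C₀ / (n : ℝ))) ?_ fun y => ?_
    · exact summable_sum fun β _ => ((summable_exp_shift hδ x).mul_left C).mul_right _
    · rw [Real.norm_eq_abs]
      refine (Finset.abs_sum_le_sum_abs _ _).trans (Finset.sum_le_sum fun β _ => ?_)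
      rw [abs_mul]
      exact mul_le_mul (hGa x y α β) (hG' y β) (abs_nonneg _) (by positivity)
  rw [happ, tsum_eq_tsum_blocks m hsum]
  set M : ℝ := C₁ * C₀ * (n : ℝ) * Real.exp (-(min δ₁ δC / 2 * dist (blk m x) (blk m u))) with hM
  have hM0 : 0 ≤ M := by positivity
  have hblk : ∀ w' : X 4, |∑ y ∈ B m w', F y| ≤ M * Real.exp (-(δ₁ / 2 * dist (blk m x) w')) := by
    intro w'
    have h1 : |∑ y ∈ B m w', F y| ≤ (∑ y ∈ B m w', ∑ β : Fin 4, |Ga n a x y α β|) * (C₀ / (n : ℝ) * Real.exp (-(δC * dist (blk m u) w'))) := by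
      calc |∑ y ∈ B m w', F y| ≤ ∑ y ∈ B m w', |F y| := Finset.abs_sum_le_sum_abs _ _
        _ ≤ ∑ y ∈ B m w', (∑ β : Fin 4, |Ga n a x y α β|) * (C₀ / (n : ℝ) * Real.exp (-(δC * dist (blk m u) w'))) :=
            Finset.sum_le_sum fun y hy => by have h := hFle y; rwa [mem_B.1 hy] at h
        _ = _ := by rw [Finset.sum_mul]
    have h2 := hmass n x w' α
    have hd1 : 0 ≤ dist (blk m x) w' := dist_nonneg
    have hd2 : 0 ≤ dist w' (blk m u) := dist_nonneg
    have htri : dist (blk m x) (blk m u) ≤ dist (blk m x) w' + dist w' (blk m u) := dist_triangle _ _ _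
    have hexp := exp_blocks_le hδ₁.le hδC0.le hd1 hd2 htri
    rw [dist_comm (blk m u) w'] at h1
    calc |∑ y ∈ B m w', F y|
        ≤ (C₁ * (n : ℝ) ^ 2 * Real.exp (-(δ₁ * dist (blk m x) w'))) * (C₀ / (n : ℝ) * Real.exp (-(δC * dist w' (blk m u)))) :=
          h1.trans (mul_le_mul_of_nonneg_right h2 (by positivity))
      _ = C₁ * C₀ * (n : ℝ) * (Real.exp (-(δ₁ * dist (blk m x) w')) * Real.exp (-(δC * dist w' (blk m u)))) := by field_simp
      _ ≤ C₁ * C₀ * (n : ℝ) * (Real.exp (-(min δ₁ δC / 2 * dist (blk m x) (blk m u))) * Real.exp (-(δ₁ / 2 * dist (blk m x) w'))) :=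
          mul_le_mul_of_nonneg_left hexp (by positivity)
      _ = M * Real.exp (-(δ₁ / 2 * dist (blk m x) w')) := by rw [hM]; ring
  refine (abs_tsum_le_latticeConst (half_pos hδ₁) hM0 (blk m x) hblk).trans (le_of_eq ?_)
  rw [hM, hC₀]; ring

/-- [folklore] **(kN), TRANSPOSED PLACEMENT** `(∇C_u Ga)(z,β)` — the same bound (`applyKT_eq_applyK_of_symm`). -/
theorem exists_applyKT_gradC_le (h12 : B5.Prop12Printed (fam nOf hn1 MOf a ha)) (h126 : B5.Kernel126_127Printed (kfam nOf MOf)) :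
    ∃ kN δ₂ : ℝ, 0 < δ₂ ∧ 0 ≤ kN ∧ ∀ (n : ℕ) [NeZero n] (cQ : ℝ) (u z : Pt) (β : Fin 4),
      |applyKT (grad (fun q => cQ * (∑ z ∈ B (n - 1) (blk (n - 1) u), Pgt n a z q () ()) - kerP (d := 4) (n - 1) a q (blk (n - 1) u))) (Ga n a) z β|
        ≤ kN * (|cQ| * cPPs 4 a + cPs 4 a) * (n : ℝ) * Real.exp (-(δ₂ * dist (blk (n - 1) z) (blk (n - 1) u))) := by
  obtain ⟨kN, δ₂, hδ₂, hkN, h⟩ := exists_applyK_gradC_le a ha h12 h126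
  exact ⟨kN, δ₂, hδ₂, hkN, fun n _ cQ u z β => by rw [applyKT_eq_applyK_of_symm a ha n]; exact h n cQ u z β⟩

/-! ## §3 The two decaying pairings of the column factor -/

/-- [folklore] the elementary block-sum bound: for `|f x| ≤ A·e^{−α·dist(blk x, p̄)}` and `|g x| ≤ B·e^{−β·dist(q̄, blk x)}` on EVERY site, the fine pairing over one
block is `≤ n⁴·A·B·e^{−α d(w′,p̄)}·e^{−β d(q̄,w′)}` and the total `|Σ'_x Σ_α f·g| ≤ 4·n⁴·A·B·K₄(α∕2)·e^{−(min α β∕2)·dist(q̄,p̄)}` — packaged as a lemma on bond functions. -/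
theorem abs_pairing_le_of_blockDecays (n : ℕ) [NeZero n] {ψ χ : Site 4 → Fin 4 → ℝ} {A Bc α β : ℝ} (hA : 0 ≤ A) (hB : 0 ≤ Bc) (hα : 0 < α) (hβ : 0 < β)
    (p q : X 4) (hψ : ∀ x c, |ψ x c| ≤ A * Real.exp (-(α * dist (blk (n - 1) x) p)))
    (hχ : ∀ x c, |χ x c| ≤ Bc * Real.exp (-(β * dist q (blk (n - 1) x))))
    (hs : Summable fun x => ∑ c : Fin 4, ψ x c * χ x c) :
    |pairing ψ χ| ≤ 4 * (n : ℝ) ^ 4 * A * Bc * latticeConst 4 (α / 2) * Real.exp (-(min α β / 2 * dist p q)) := by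
  have hn : (0 : ℝ) < n := by exact_mod_cast Nat.pos_of_ne_zero (NeZero.ne n)
  set m : ℕ := n - 1 with hm
  have hmn : ((m : ℝ) + 1) = n := cast_pred_add_one n
  rw [pairing_def, tsum_eq_tsum_blocks m hs]
  set M : ℝ := 4 * (n : ℝ) ^ 4 * A * Bc * Real.exp (-(min α β / 2 * dist p q)) with hM
  have hM0 : 0 ≤ M := by positivity
  have hblk : ∀ w' : X 4, |∑ x ∈ B m w', ∑ c : Fin 4, ψ x c * χ x c| ≤ M * Real.exp (-(α / 2 * dist p w')) := by
    intro w'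
    have hd1 : 0 ≤ dist w' p := dist_nonneg
    have hd2 : 0 ≤ dist q w' := dist_nonneg
    have htri : dist q p ≤ dist q w' + dist w' p := dist_triangle _ _ _
    have hterm : ∀ x ∈ B m w', |∑ c : Fin 4, ψ x c * χ x c| ≤ 4 * (A * Real.exp (-(α * dist w' p)) * (Bc * Real.exp (-(β * dist q w')))) := by
      intro x hx
      have hbx : blk m x = w' := mem_B.1 hx
      calc |∑ c : Fin 4, ψ x c * χ x c| ≤ ∑ c : Fin 4, |ψ x c * χ x c| := Finset.abs_sum_le_sum_abs _ _
        _ ≤ ∑ _c : Fin 4, A * Real.exp (-(α * dist w' p)) * (Bc * Real.exp (-(β * dist q w'))) :=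
            Finset.sum_le_sum fun c _ => by
              rw [abs_mul]
              have h1 := hψ x c; have h2 := hχ x c
              rw [hbx] at h1 h2
              exact mul_le_mul h1 h2 (abs_nonneg _) (by positivity)
        _ = _ := by rw [Finset.sum_const, Finset.card_univ, Fintype.card_fin, nsmul_eq_mul]; push_cast; ring
    have htri' : dist q p ≤ dist w' p + dist q w' := by linarith
    have hexp : Real.exp (-(α * dist w' p)) * Real.exp (-(β * dist q w')) ≤ Real.exp (-(min α β / 2 * dist q p)) * Real.exp (-(α / 2 * dist w' p)) :=
      exp_blocks_le hα.le hβ.le hd1 hd2 htri'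
    calc |∑ x ∈ B m w', ∑ c : Fin 4, ψ x c * χ x c| ≤ ∑ x ∈ B m w', |∑ c : Fin 4, ψ x c * χ x c| := Finset.abs_sum_le_sum_abs _ _
      _ ≤ ∑ _x ∈ B m w', 4 * (A * Real.exp (-(α * dist w' p)) * (Bc * Real.exp (-(β * dist q w')))) := Finset.sum_le_sum hterm
      _ = (n : ℝ) ^ 4 * (4 * (A * Bc * (Real.exp (-(α * dist w' p)) * Real.exp (-(β * dist q w'))))) := by
          rw [Finset.sum_const, nsmul_eq_mul, card_B, hmn]; ring
      _ ≤ (n : ℝ) ^ 4 * (4 * (A * Bc * (Real.exp (-(min α β / 2 * dist q p)) * Real.exp (-(α / 2 * dist w' p))))) := by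
          gcongr
      _ = M * Real.exp (-(α / 2 * dist p w')) := by rw [hM, dist_comm p q, dist_comm p w']; ring
  refine (abs_tsum_le_latticeConst (half_pos hα) hM0 p hblk).trans (le_of_eq ?_)
  rw [hM]; ring

/-- [folklore] **BLOCK DECAY ⟹ SUMMABLE** (uniformly bounded partial sums `≤ M·n⁴·K₄(δ)` by `NeedleGhostBubble2Row.sum_le_of_blockDecay_mass` with `F ≡ 1`). -/
theorem summable_of_blockDecay (n : ℕ) [NeZero n] {f : Site 4 → ℝ} {M δ : ℝ} (hM : 0 ≤ M) (hδ : 0 < δ) (p : X 4)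
    (h : ∀ x, |f x| ≤ M * Real.exp (-(δ * dist p (blk (n - 1) x)))) : Summable f := by
  have hmn : (((n - 1 : ℕ) : ℝ) + 1) = n := cast_pred_add_one n
  have hblk : ∀ β' : Site 4, ∑ _u ∈ B (n - 1) β', (1 : ℝ) ≤ (n : ℝ) ^ 4 := fun β' => by
    rw [Finset.sum_const, nsmul_eq_mul, mul_one, card_B, hmn]
  have hfin : ∀ S : Finset (Site 4), ∑ x ∈ S, |f x| ≤ M * (n : ℝ) ^ 4 * latticeConst 4 δ := fun S =>
    NeedleGhostBubble2Row.sum_le_of_blockDecay_mass n (h := fun x => |f x|) (F := fun _ => (1 : ℝ)) (fun x => abs_nonneg _)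
      (fun _ => zero_le_one) hM hδ p (fun x => by simpa using h x) hblk S
  exact (summable_of_sum_le (fun x => abs_nonneg (f x)) hfin).of_abs

/-- [folklore] **(kNP) `|⟨Ga ∇C_u, ∇_row P(p,·)⟩| ≤ kNP·(|cQ|·cPPs + cPs)·e^{−δ₃·dist(blk u, blk p)}`** (n⁰: `(kN C₀ n)·(cPPs n⁻⁵)·n⁴` per block), modulo the printed leg letters. -/
theorem exists_pairing_applyK_gradC_rowGrad_le (h12 : B5.Prop12Printed (fam nOf hn1 MOf a ha)) (h126 : B5.Kernel126_127Printed (kfam nOf MOf)) :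
    ∃ kNP δ₃ : ℝ, 0 < δ₃ ∧ 0 ≤ kNP ∧ ∀ (n : ℕ) [NeZero n] (cQ : ℝ) (u p : Pt),
      |pairing (applyK (Ga n a) (grad (fun q => cQ * (∑ z ∈ B (n - 1) (blk (n - 1) u), Pgt n a z q () ()) - kerP (d := 4) (n - 1) a q (blk (n - 1) u))))
          (rowGrad (Pgt n a) p)|
        ≤ kNP * (|cQ| * cPPs 4 a + cPs 4 a) * Real.exp (-(δ₃ * dist (blk (n - 1) u) (blk (n - 1) p))) := by
  obtain ⟨kN, δ₂, hδ₂, hkN, hN⟩ := exists_applyK_gradC_le a ha h12 h126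
  have hPP := deltaPP_pos 4 ha; have hcP := cPPs_nonneg 4 ha; have hcs := cPs_nonneg 4 ha
  refine ⟨4 * kN * cPPs 4 a * latticeConst 4 (δ₂ / 2), min δ₂ (deltaPP 4 a) / 2, half_pos (lt_min hδ₂ hPP),
    by have := latticeConst_nonneg 4 (half_pos hδ₂).le; positivity, fun n _ cQ u p => ?_⟩
  have hn : (0 : ℝ) < n := by exact_mod_cast Nat.pos_of_ne_zero (NeZero.ne n)
  set C₀ : ℝ := |cQ| * cPPs 4 a + cPs 4 a with hC₀
  have hC₀0 : 0 ≤ C₀ := by positivity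
  -- the two pointwise letters
  have hψ : ∀ (x : Pt) (c : Fin 4), |applyK (Ga n a) (grad (fun q => cQ * (∑ z ∈ B (n - 1) (blk (n - 1) u), Pgt n a z q () ())
        - kerP (d := 4) (n - 1) a q (blk (n - 1) u))) x c| ≤ kN * C₀ * (n : ℝ) * Real.exp (-(δ₂ * dist (blk (n - 1) x) (blk (n - 1) u))) :=
    fun x c => hN n cQ u x c
  have hχ : ∀ (x : Pt) (c : Fin 4), |rowGrad (Pgt n a) p x c| ≤ cPPs 4 a / (n : ℝ) ^ 5 * Real.exp (-(deltaPP 4 a * dist (blk (n - 1) p) (blk (n - 1) x))) := by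
    intro x c
    simp only [rowGrad]
    rw [Pgt_symm n ha p (x + unitVec c), Pgt_symm n ha p x, unitVec_eq_e']
    have h := abs_Pgt_diff_le_sup n ha x p c () ()
    rwa [dist_comm] at h
  -- summability from the χ side (the ∇P row is absolutely summable) and the bounded ψ side
  have hs : Summable fun x => ∑ c : Fin 4, applyK (Ga n a) (grad (fun q => cQ * (∑ z ∈ B (n - 1) (blk (n - 1) u), Pgt n a z q () ())
      - kerP (d := 4) (n - 1) a q (blk (n - 1) u))) x c * rowGrad (Pgt n a) p x c := by
    have hχs : Summable fun x : Pt => cPPs 4 a / (n : ℝ) ^ 5 * Real.exp (-(deltaPP 4 a * dist (blk (n - 1) p) (blk (n - 1) x))) :=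
      summable_of_blockDecay n (M := cPPs 4 a / (n : ℝ) ^ 5) (δ := deltaPP 4 a) (by positivity) hPP (blk (n - 1) p) fun x => by
        rw [abs_of_nonneg (by positivity)]
    refine Summable.of_norm_bounded (g := fun x => ∑ _c : Fin 4, (kN * C₀ * (n : ℝ)) *
        (cPPs 4 a / (n : ℝ) ^ 5 * Real.exp (-(deltaPP 4 a * dist (blk (n - 1) p) (blk (n - 1) x))))) (summable_sum fun c _ => hχs.mul_left _) fun x => ?_
    rw [Real.norm_eq_abs]
    refine (Finset.abs_sum_le_sum_abs _ _).trans (Finset.sum_le_sum fun c _ => ?_)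
    rw [abs_mul]
    refine mul_le_mul ((hψ x c).trans (mul_le_of_le_one_right (by positivity) ?_)) (hχ x c) (abs_nonneg _) (by positivity)
    rw [Real.exp_le_one_iff]; have : 0 ≤ δ₂ * dist (blk (n - 1) x) (blk (n - 1) u) := by positivity
    linarith
  have h := abs_pairing_le_of_blockDecays n (by positivity : 0 ≤ kN * C₀ * (n : ℝ)) (by positivity : 0 ≤ cPPs 4 a / (n : ℝ) ^ 5) hδ₂ hPP
    (blk (n - 1) u) (blk (n - 1) p) hψ hχ hs
  refine h.trans (le_of_eq ?_)
  rw [hC₀, dist_comm (blk (n - 1) u) (blk (n - 1) p)]; field_simp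

/-- [folklore] **(kCP) `|⟨∇C_u, Ga ∇_col P(·,q)⟩| ≤ kCP·(|cQ|·cPPs + cPs)·e^{−δ₃·dist(blk u, blk q)}`** (n⁰: `(C₀∕n)·(kC n⁻³)·n⁴` per block), modulo the printed leg letters. -/
theorem exists_pairing_gradC_applyK_colGrad_le (h12 : B5.Prop12Printed (fam nOf hn1 MOf a ha)) (h126 : B5.Kernel126_127Printed (kfam nOf MOf)) :
    ∃ kCP δ₃ : ℝ, 0 < δ₃ ∧ 0 ≤ kCP ∧ ∀ (n : ℕ) [NeZero n] (cQ : ℝ) (u q : Pt),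
      |pairing (grad (fun q' => cQ * (∑ z ∈ B (n - 1) (blk (n - 1) u), Pgt n a z q' () ()) - kerP (d := 4) (n - 1) a q' (blk (n - 1) u)))
          (applyK (Ga n a) (colGrad (Pgt n a) q))|
        ≤ kCP * (|cQ| * cPPs 4 a + cPs 4 a) * Real.exp (-(δ₃ * dist (blk (n - 1) u) (blk (n - 1) q))) := by
  obtain ⟨kC, δ₁, hδ₁, hkC, hKC⟩ := exists_applyK_colGrad_le a ha h12 h126
  have hPP := deltaPP_pos 4 ha; have hP := deltaP_pos 4 ha; have hcP := cPPs_nonneg 4 ha; have hcs := cPs_nonneg 4 ha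
  set δC := min (deltaPP 4 a) (deltaP 4 a) with hδC
  have hδC0 : 0 < δC := lt_min hPP hP
  refine ⟨4 * kC * latticeConst 4 (δC / 2), min δC δ₁ / 2, half_pos (lt_min hδC0 hδ₁),
    by have := latticeConst_nonneg 4 (half_pos hδC0).le; positivity, fun n _ cQ u q => ?_⟩
  have hn : (0 : ℝ) < n := by exact_mod_cast Nat.pos_of_ne_zero (NeZero.ne n)
  set C₀ : ℝ := |cQ| * cPPs 4 a + cPs 4 a with hC₀
  have hC₀0 : 0 ≤ C₀ := by positivity
  have hψ : ∀ (x : Pt) (c : Fin 4), |grad (fun q' => cQ * (∑ z ∈ B (n - 1) (blk (n - 1) u), Pgt n a z q' () ())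
      - kerP (d := 4) (n - 1) a q' (blk (n - 1) u)) x c| ≤ C₀ / (n : ℝ) * Real.exp (-(δC * dist (blk (n - 1) u) (blk (n - 1) x))) :=
    fun x c => abs_gradC_le a ha n cQ u x c
  have hψ' : ∀ (x : Pt) (c : Fin 4), |grad (fun q' => cQ * (∑ z ∈ B (n - 1) (blk (n - 1) u), Pgt n a z q' () ())
      - kerP (d := 4) (n - 1) a q' (blk (n - 1) u)) x c| ≤ C₀ / (n : ℝ) * Real.exp (-(δC * dist (blk (n - 1) x) (blk (n - 1) u))) :=
    fun x c => by rw [dist_comm]; exact hψ x c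
  have hχ : ∀ (x : Pt) (c : Fin 4), |applyK (Ga n a) (colGrad (Pgt n a) q) x c| ≤ kC / (n : ℝ) ^ 3 * Real.exp (-(δ₁ * dist (blk (n - 1) q) (blk (n - 1) x))) :=
    fun x c => by rw [dist_comm]; exact hKC n q x c
  have hs : Summable fun x => ∑ c : Fin 4, grad (fun q' => cQ * (∑ z ∈ B (n - 1) (blk (n - 1) u), Pgt n a z q' () ())
      - kerP (d := 4) (n - 1) a q' (blk (n - 1) u)) x c * applyK (Ga n a) (colGrad (Pgt n a) q) x c := by
    have hψs : Summable fun x : Pt => C₀ / (n : ℝ) * Real.exp (-(δC * dist (blk (n - 1) u) (blk (n - 1) x))) :=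
      summable_of_blockDecay n (M := C₀ / (n : ℝ)) (δ := δC) (by positivity) hδC0 (blk (n - 1) u) fun x => by rw [abs_of_nonneg (by positivity)]
    refine Summable.of_norm_bounded (g := fun x => ∑ _c : Fin 4, (C₀ / (n : ℝ) * Real.exp (-(δC * dist (blk (n - 1) u) (blk (n - 1) x)))) *
        (kC / (n : ℝ) ^ 3)) (summable_sum fun c _ => hψs.mul_right _) fun x => ?_
    rw [Real.norm_eq_abs]
    refine (Finset.abs_sum_le_sum_abs _ _).trans (Finset.sum_le_sum fun c _ => ?_)
    rw [abs_mul]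
    refine mul_le_mul (hψ x c) ((hχ x c).trans (mul_le_of_le_one_right (by positivity) ?_)) (abs_nonneg _) (by positivity)
    rw [Real.exp_le_one_iff]; have : 0 ≤ δ₁ * dist (blk (n - 1) q) (blk (n - 1) x) := by positivity
    linarith
  have h := abs_pairing_le_of_blockDecays n (by positivity : 0 ≤ C₀ / (n : ℝ)) (by positivity : 0 ≤ kC / (n : ℝ) ^ 3) hδC0 hδ₁
    (blk (n - 1) u) (blk (n - 1) q) hψ' hχ hs
  refine h.trans (le_of_eq ?_)
  rw [hC₀]; field_simp

end

end Summit.QuantumFields.BalabanUV.Beta.D1BFx.NeedleColumnLetters
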